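import Mathlib
import Summits.CriticalPhenomena.CardyFormulaZ2.Theorems.CardyMagicRigidityNestingRigidityStaircaseCloud
import Summits.CriticalPhenomena.CardyFormulaZ2.Theorems.CardyMagicRigidityNestingRigidityConeTiltLoopSide
import Summits.CriticalPhenomena.CardyFormulaZ2.Theorems.CardyMagicRigidityNestingRigidityUVLinearisation
import Literature.Probability.Percolation.LoopRotationInvarianceProofs
import Literature.Probability.Percolation.FKLoopNestingMeasurable
import Summits.CriticalPhenomena.CardyFormulaZ2.Theorems.CardyMagicRigidityNestingRigidityFusionBaseCases
import HarnessLib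

/-!
# Crux `NestingRigidity`, line `ring-cloud-tomography` (r5): the staircase functional PATHWISE
# (stub R2' `stub_staircaseDecoupling`, both lattices) — phase window, linearisation, sandwich

Crux `Summit.CriticalPhenomena.CardyFormulaZ2.Theses.CardyMagicRigidity.NestingRigidity`
(stmt-CriticalPhenomena-4835), line `ring-cloud-tomography`, stub R2'.  Sequel to `…StaircaseCloud`
(p110700).  The staircase cloud is the bump `t·ρ_{B(0,r)}` plus `k` rings `A(0; L j, M j)` of equal
charge `−t/k`; everything here is deterministic or sample-wise at a fixed mesh:
* §1 `Staircase.nestingPhase_le_div_or_cross` / `nestingPhase_mem_Icc_or_cross`: for `t ≤ 0 < k`,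
  `r ≤ L j`, every loop has phase in `[t, −t/k]` UNLESS its trace meets `B̄(0, M j₁)` and leaves
  `B(0, L j₂)` for two rings `j₁ < j₂` (a gap crossing);
* §2 `UVLinear.exp_le_magicWeight_of_mem_Icc`, `prod_nestingFactor_mem_Icc_of_mem_Icc`: the two-sided
  multiplicative linearisation `exp(−√3θ − θ²/c) ≤ w(θ) ≤ exp(−√3θ)` on an ASYMMETRIC window
  `[lo, hi]`, `−5π/6 < lo ≤ 0 ≤ hi < π/6`, `c = min (cos(lo+π/3)) (cos(hi+π/3))`;
* §3 admissibility data of the staircase density; §4 on both lattice ensembles, pathwise: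
  `A = g_tot · U_rest` (registered anchor `staircase_nestingWeight_eq_tow_mul_rest`), `g_tot ≥ 0`
  (`g_tot` = product of the weights of the window tower and of the gap towers, which never cross a
  gap), and on the good event (no gap crossing) the sandwich
  `exp(−√3Θ − Θ₂/c) ≤ U_rest ≤ exp(−√3Θ)`, `Θ, Θ₂` the finite (squared-)phase sums of the rest loops,
  `c = min (cos(t+π/3)) (cos(−t/k+π/3))` (needs only `−t < kπ/6`).
The exact phases of the gap towers are in `…StaircaseGapTowers`; the measure-theoretic reduction of
the stub to its remaining input is the sequel `…StaircaseReduction`.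
-/

noncomputable section

open MeasureTheory Set Filter Metric
open scoped Real Topology BigOperators

namespace Summit.CriticalPhenomena.CardyFormulaZ2.Cruxes.NestingRigidity.RingCloudTomography

open Literature.Probability.RandomPlanarGeometry Literature.Probability.Percolation
  Literature.Probability.LatticeModels
open Summit.CriticalPhenomena.CardyFormulaZ2.Cruxes.NestingRigidity.PositiveConeWeightDoubling
  (magicWeight)

namespace Staircase

section StaircaseCloud

variable {𝔠 : Cloud} {t r : ℝ} {k : ℕ} {L M : Fin k → ℝ}
  (h𝔠 : 𝔠 = Cloud.mk 1 k (fun _ ↦ 0) (fun _ ↦ r) (fun _ ↦ t) (fun _ ↦ 0) L M (fun _ ↦ -t / k))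
include h𝔠

/-! ## §1 Sharper classification: phase `≤ −t/k` or a gap crossing -/

/-- **Sharper classification (phase form).** For the staircase with `t ≤ 0`, `0 < k`, the bump inside
every ring (`r ≤ L j`): a loop has phase `≤ −t/k` UNLESS its trace meets `B̄(0, M j₁)` and leaves
`B(0, L j₂)` for two rings `j₁ < j₂` (`θ_u > −t/k` forces `Σ_j φ_j > 1`, so two rings are bitten,
which without a gap crossing swallows the bump and gives `θ_u ≤ 0`). -/
theorem nestingPhase_le_div_or_cross (ht : t ≤ 0) (hk : 0 < k) (hr : 0 < r)
    (hrL : ∀ j, r ≤ L j) (hL : ∀ j, 0 < L j) (hLM : ∀ j, L j < M j) (u : UnbasedLoop ℂ) :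
    u.nestingPhase 𝔠.density ≤ -t / k ∨
      ∃ j₁ j₂, j₁ < j₂ ∧ (u.range ∩ closedBall (0 : ℂ) (M j₁)).Nonempty ∧
        (u.range ∩ (ball (0 : ℂ) (L j₂))ᶜ).Nonempty := by
  set U : Set ℂ := {z | u.wind z ≠ 0}
  set φ₀ : ℝ := ∫ z in U, discDensity 0 r z
  set φ : Fin k → ℝ := fun j ↦ ∫ z in U, annulusDensity 0 (L j) (M j) z
  have hθ : u.nestingPhase 𝔠.density = t * φ₀ + -t / k * ∑ j, φ j := nestingPhase_eq h𝔠 u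
  have h₀ : φ₀ ∈ Set.Icc (0 : ℝ) 1 := ConeTilt.setIntegral_discDensity_mem_Icc 0 hr U
  have h₁ : ∀ j, φ j ∈ Set.Icc (0 : ℝ) 1 :=
    fun j ↦ ConeTilt.setIntegral_annulusDensity_mem_Icc 0 (hL j) (hLM j) U
  have hkpos : (0 : ℝ) < k := Nat.cast_pos.2 hk
  have hg : 0 ≤ -t / k := div_nonneg (neg_nonneg.2 ht) hkpos.le
  by_cases hcross : ∃ j₁ j₂, j₁ < j₂ ∧ (u.range ∩ closedBall (0 : ℂ) (M j₁)).Nonempty ∧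
      (u.range ∩ (ball (0 : ℂ) (L j₂))ᶜ).Nonempty
  · exact Or.inr hcross
  refine Or.inl (not_lt.1 fun hgt ↦ ?_)
  rw [hθ] at hgt
  -- two rings bitten with positive fractions is impossible without a gap crossing
  have key : ∀ j₁ j₂, j₁ < j₂ → 0 < φ j₁ → 0 < φ j₂ → False := by
    intro j₁ j₂ hlt hp₁ hp₂
    by_cases hA : (u.range ∩ closedBall (0 : ℂ) (M j₁)).Nonempty
    · by_cases hB : (u.range ∩ (ball (0 : ℂ) (L j₂))ᶜ).Nonempty
      · exact hcross ⟨j₁, j₂, hlt, hA, hB⟩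
      · have hsub : u.range ⊆ ball (0 : ℂ) (L j₂) := fun x hx ↦ by_contra fun h ↦ hB ⟨x, hx, h⟩
        exact hp₂.ne' (ConeTilt.setIntegral_annulusDensity_eq_zero 0 (L j₂) (M j₂) (Set.disjoint_left.2
          fun z hz hz' ↦ hz (wind_eq_zero_of_range_subset_ball hsub (by simpa using hz'.1))))
    · have hsub : u.range ⊆ (closedBall (0 : ℂ) (M j₁))ᶜ := fun x hx hx' ↦ hA ⟨x, hx, hx'⟩
      obtain ⟨z, hzU, hz⟩ : (U ∩ {z : ℂ | L j₁ ≤ ‖z - 0‖ ∧ ‖z - 0‖ < M j₁}).Nonempty := by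
        by_contra hem
        exact hp₁.ne' (ConeTilt.setIntegral_annulusDensity_eq_zero 0 (L j₁) (M j₁)
          (Set.disjoint_iff_inter_eq_empty.2 (Set.not_nonempty_iff_eq_empty.1 hem)))
      have hzB : z ∈ closedBall (0 : ℂ) (M j₁) := mem_closedBall_zero_iff.2 (by simpa using hz.2.le)
      have hφ₀1 : φ₀ = 1 := ConeTilt.setIntegral_discDensity_eq_one 0 hr fun w hw ↦ by
        have hwB : w ∈ closedBall (0 : ℂ) (M j₁) :=
          mem_closedBall_zero_iff.2 (by linarith [hrL j₁, hLM j₁, mem_ball_zero_iff.1 hw])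
        simpa only [U, mem_setOf_eq, wind_eq_of_range_subset_compl hsub hwB hzB] using hzU
      have hsum : ∑ j, φ j ≤ k := (Finset.sum_le_sum fun j _ ↦ (h₁ j).2).trans (by simp)
      have hle : -t / k * ∑ j, φ j ≤ -t := (mul_le_mul_of_nonneg_left hsum hg).trans
        (div_mul_cancel₀ _ hkpos.ne').le
      rw [hφ₀1, mul_one] at hgt
      linarith
  -- from `θ_u > −t/k`: the ring fractions sum to more than `1`
  have hsum1 : 1 < ∑ j, φ j := by
    by_contra hle
    have : -t / k * ∑ j, φ j ≤ -t / k * 1 := mul_le_mul_of_nonneg_left (not_lt.1 hle) hg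
    nlinarith [h₀.2, h₀.1]
  obtain ⟨j, -, hj⟩ : ∃ j ∈ (Finset.univ : Finset (Fin k)), 0 < φ j := by
    by_contra h; push Not at h; linarith [Finset.sum_nonpos h]
  obtain ⟨j', hj'mem, hj'⟩ : ∃ j' ∈ Finset.univ.erase j, 0 < φ j' := by
    by_contra h; push Not at h
    linarith [(h₁ j).2, Finset.sum_nonpos h, Finset.add_sum_erase Finset.univ φ (Finset.mem_univ j)]
  rcases lt_or_gt_of_ne (Finset.ne_of_mem_erase hj'mem) with h | h
  · exact key j' j h hj' hj
  · exact key j j' h hj hj'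

/-- **Phase window of non-crossing loops**: for `t ≤ 0 < k`, `r ≤ L j`, every loop has phase in
`[t, −t/k]` or crosses a gap (with `le_nestingPhase`). -/
theorem nestingPhase_mem_Icc_or_cross (ht : t ≤ 0) (hk : 0 < k) (hr : 0 < r)
    (hrL : ∀ j, r ≤ L j) (hL : ∀ j, 0 < L j) (hLM : ∀ j, L j < M j) (u : UnbasedLoop ℂ) :
    u.nestingPhase 𝔠.density ∈ Set.Icc t (-t / k) ∨
      ∃ j₁ j₂, j₁ < j₂ ∧ (u.range ∩ closedBall (0 : ℂ) (M j₁)).Nonempty ∧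
        (u.range ∩ (ball (0 : ℂ) (L j₂))ᶜ).Nonempty :=
  (nestingPhase_le_div_or_cross h𝔠 ht hk hr hrL hL hLM u).imp_left fun h ↦
    ⟨le_nestingPhase h𝔠 ht hr hL hLM u, h⟩

end StaircaseCloud

end Staircase

/-! ## §2 Asymmetric two-sided linearisation of the weight -/

namespace UVLinear

/-- A function whose derivative is `≥ 0` on `(0, hi)` and `≤ 0` on `(lo, 0)` attains its minimum over
`[lo, hi]` (`lo ≤ 0 ≤ hi`) at `0`. -/
theorem apply_zero_le_of_deriv_Icc {g g' : ℝ → ℝ} {lo hi : ℝ} (hlo : lo ≤ 0) (hhi : 0 ≤ hi)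
    (hg : ∀ x, HasDerivAt g (g' x) x) (hpos : ∀ x ∈ Set.Ioo 0 hi, 0 ≤ g' x)
    (hneg : ∀ x ∈ Set.Ioo lo 0, g' x ≤ 0) {x : ℝ} (hx : x ∈ Set.Icc lo hi) : g 0 ≤ g x := by
  have hc : Continuous g := continuous_iff_continuousAt.2 fun x ↦ (hg x).continuousAt
  rcases le_total 0 x with h0x | hx0
  · have hm : MonotoneOn g (Set.Icc 0 hi) :=
      monotoneOn_of_hasDerivWithinAt_nonneg (convex_Icc 0 hi) hc.continuousOn
        (fun y _ ↦ (hg y).hasDerivWithinAt) fun y hy ↦ hpos y (by rwa [interior_Icc] at hy)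
    exact hm ⟨le_rfl, hhi⟩ ⟨h0x, hx.2⟩ h0x
  · have hm : AntitoneOn g (Set.Icc lo 0) :=
      antitoneOn_of_hasDerivWithinAt_nonpos (convex_Icc lo 0) hc.continuousOn
        (fun y _ ↦ (hg y).hasDerivWithinAt) fun y hy ↦ hneg y (by rwa [interior_Icc] at hy)
    exact hm ⟨hx.1, hx0⟩ ⟨hlo, le_rfl⟩ hx0

/-- **Lower linearisation on an asymmetric window**: for `−5π/6 < lo ≤ 0 ≤ hi < π/6` and
`θ ∈ [lo, hi]`, `exp(−√3θ − θ²/c) ≤ w(θ)` with `c = min (cos(lo + π/3)) (cos(hi + π/3)) > 0`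
(on `[lo, hi]`, `cos(θ + π/3) ≥ c` and `|sin θ| ≤ |θ|`). -/
theorem exp_le_magicWeight_of_mem_Icc {lo hi θ : ℝ} (hlo : -(5 * π / 6) < lo) (hlo0 : lo ≤ 0)
    (hhi0 : 0 ≤ hi) (hhi : hi < π / 6) (hθ : θ ∈ Set.Icc lo hi) :
    Real.exp (-(Real.sqrt 3 * θ) - θ ^ 2 / min (Real.cos (lo + π / 3)) (Real.cos (hi + π / 3))) ≤
      magicWeight θ := by
  set c := min (Real.cos (lo + π / 3)) (Real.cos (hi + π / 3)) with hc
  have hclo : 0 < Real.cos (lo + π / 3) := Real.cos_pos_of_mem_Ioo ⟨by linarith, by linarith [Real.pi_pos]⟩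
  have hchi : 0 < Real.cos (hi + π / 3) := Real.cos_pos_of_mem_Ioo ⟨by linarith [Real.pi_pos], by linarith⟩
  have hcpos : 0 < c := lt_min hclo hchi
  -- `cos(x + π/3) ≥ c` on `[lo, hi]`: the minimum of `cos` on an interval inside `(−π/2, π/2)` is at an end
  have hcos : ∀ x ∈ Set.Icc lo hi, c ≤ Real.cos (x + π / 3) := by
    intro x hx
    rcases le_total 0 (x + π / 3) with h | h
    · exact (min_le_right _ _).trans (Real.cos_le_cos_of_nonneg_of_le_pi h (by linarith [Real.pi_pos])
        (by linarith [hx.2]))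
    · have e1 : Real.cos (x + π / 3) = Real.cos (-(x + π / 3)) := (Real.cos_neg _).symm
      have e2 : Real.cos (lo + π / 3) = Real.cos (-(lo + π / 3)) := (Real.cos_neg _).symm
      rw [e1]
      refine (min_le_left _ _).trans (e2 ▸ Real.cos_le_cos_of_nonneg_of_le_pi (by linarith)
        (by linarith [Real.pi_pos]) (by linarith [hx.1]))
  have hd := hasDerivAt_exp_mul_magicWeight c⁻¹
  have h := apply_zero_le_of_deriv_Icc hlo0 hhi0 hd (fun x hx ↦ ?_) (fun x hx ↦ ?_) hθ
  · simp only [mul_zero, add_zero, Real.exp_zero, one_mul, ne_eq, OfNat.ofNat_ne_zero,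
      not_false_eq_true, zero_pow] at h
    rw [show magicWeight 0 = 1 by rw [magicWeight, zero_add, Real.cos_pi_div_three]; norm_num] at h
    calc Real.exp (-(Real.sqrt 3 * θ) - θ ^ 2 / c)
        = Real.exp (-(Real.sqrt 3 * θ) - θ ^ 2 / c) * 1 := (mul_one _).symm
      _ ≤ Real.exp (-(Real.sqrt 3 * θ) - θ ^ 2 / c) *
            (Real.exp (Real.sqrt 3 * θ + c⁻¹ * θ ^ 2) * magicWeight θ) :=
          mul_le_mul_of_nonneg_left h (Real.exp_pos _).le
      _ = magicWeight θ := by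
          rw [← mul_assoc, ← Real.exp_add, div_eq_mul_inv,
            show -(Real.sqrt 3 * θ) - θ ^ 2 * c⁻¹ + (Real.sqrt 3 * θ + c⁻¹ * θ ^ 2) = 0 by ring,
            Real.exp_zero, one_mul]
  · -- `x ∈ (0, hi)`: `c⁻¹ x cos(x + π/3) ≥ x ≥ sin x`
    have h1 : x * 1 ≤ x * (Real.cos (x + π / 3) / c) :=
      mul_le_mul_of_nonneg_left ((one_le_div hcpos).2 (hcos x ⟨by linarith [hx.1], hx.2.le⟩)) hx.1.le
    rw [div_eq_mul_inv] at h1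
    have h2 : Real.sin x ≤ x := Real.sin_le hx.1.le
    exact mul_nonneg (by positivity) (by nlinarith)
  · -- `x ∈ (lo, 0)`
    have h1 : x * (Real.cos (x + π / 3) / c) ≤ x * 1 :=
      mul_le_mul_of_nonpos_left ((one_le_div hcpos).2 (hcos x ⟨hx.1.le, by linarith [hx.2]⟩)) hx.2.le
    rw [div_eq_mul_inv] at h1
    have h2 : x ≤ Real.sin x := by
      have := Real.sin_le (neg_nonneg.2 hx.2.le); rw [Real.sin_neg] at this; linarith
    exact mul_nonpos_of_nonneg_of_nonpos (by positivity) (by nlinarith)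

/-- **The finite-product sandwich on an asymmetric window**: for finitely many loops with phases in
`[lo, hi]` (`−5π/6 < lo ≤ 0 ≤ hi < π/6`),
`exp(−√3 Σθ − (Σθ²)/c) ≤ ∏ w_u ≤ exp(−√3 Σθ)`, `c = min (cos(lo + π/3)) (cos(hi + π/3))`. -/
theorem prod_nestingFactor_mem_Icc_of_mem_Icc (S : Finset (UnbasedLoop ℂ)) (f : ℂ → ℝ) {lo hi : ℝ}
    (hlo : -(5 * π / 6) < lo) (hlo0 : lo ≤ 0) (hhi0 : 0 ≤ hi) (hhi : hi < π / 6)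
    (hθ : ∀ u ∈ S, UnbasedLoop.nestingPhase f u ∈ Set.Icc lo hi) :
    Real.exp (-(Real.sqrt 3 * ∑ u ∈ S, UnbasedLoop.nestingPhase f u) -
        (∑ u ∈ S, UnbasedLoop.nestingPhase f u ^ 2) / min (Real.cos (lo + π / 3)) (Real.cos (hi + π / 3))) ≤
        ∏ u ∈ S, UnbasedLoop.nestingFactor f u ∧
      ∏ u ∈ S, UnbasedLoop.nestingFactor f u ≤
        Real.exp (-(Real.sqrt 3 * ∑ u ∈ S, UnbasedLoop.nestingPhase f u)) := by
  have hfac : ∀ u, UnbasedLoop.nestingFactor f u = magicWeight (UnbasedLoop.nestingPhase f u) :=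
    fun u ↦ rfl
  have hπ : ∀ u ∈ S, |UnbasedLoop.nestingPhase f u| ≤ π := fun u hu ↦
    abs_le.2 ⟨by linarith [(hθ u hu).1, Real.pi_pos], by linarith [(hθ u hu).2, Real.pi_pos]⟩
  simp only [hfac]
  set c := min (Real.cos (lo + π / 3)) (Real.cos (hi + π / 3))
  constructor
  · rw [show -(Real.sqrt 3 * ∑ u ∈ S, UnbasedLoop.nestingPhase f u) -
        (∑ u ∈ S, UnbasedLoop.nestingPhase f u ^ 2) / c =
        ∑ u ∈ S, (-(Real.sqrt 3 * UnbasedLoop.nestingPhase f u) -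
          UnbasedLoop.nestingPhase f u ^ 2 / c) by
      rw [Finset.sum_sub_distrib, Finset.sum_div, Finset.mul_sum, Finset.sum_neg_distrib],
      Real.exp_sum]
    exact Finset.prod_le_prod (fun u _ ↦ (Real.exp_pos _).le) fun u hu ↦
      exp_le_magicWeight_of_mem_Icc hlo hlo0 hhi0 hhi (hθ u hu)
  · rw [show -(Real.sqrt 3 * ∑ u ∈ S, UnbasedLoop.nestingPhase f u) =
        ∑ u ∈ S, -(Real.sqrt 3 * UnbasedLoop.nestingPhase f u) by
      rw [Finset.mul_sum, Finset.sum_neg_distrib], Real.exp_sum]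
    exact Finset.prod_le_prod
      (fun u hu ↦ (exp_le_magicWeight_of_mem_Icc hlo hlo0 hhi0 hhi (hθ u hu)).trans' (Real.exp_pos _).le)
      fun u hu ↦ magicWeight_le_exp (hπ u hu)

end UVLinear

/-! ## §3 The staircase functional on both lattices: admissibility data -/

-- Local notation: the staircase cloud, its tower loops (window tower ∪ gap towers), the good event.
local notation3 "Stair(" k ", " L ", " M ", " t ", " r ")" =>
  Cloud.mk 1 k (fun _ ↦ (0 : ℂ)) (fun _ ↦ r) (fun _ ↦ t) (fun _ ↦ (0 : ℂ)) L M (fun _ ↦ -t / k)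
local notation3 "Tow(" c ", " k ", " L ", " M ", " r ")" =>
  {u ∈ LoopConfig.loops c | (Metric.closedBall (0 : ℂ) r ⊆ {z | u.wind z ≠ 0} ∧ u.range ⊆ Metric.ball (0 : ℂ) 1) ∨
    ∃ j : Fin k, (j : ℕ) + 1 < k ∧ Metric.closedBall (0 : ℂ) ((M : Fin k → ℝ) j) ⊆ {z | u.wind z ≠ 0} ∧
      ∀ l : Fin k, j < l → u.range ⊆ Metric.ball (0 : ℂ) ((L : Fin k → ℝ) l)}
local notation3 "Good(" c ", " k ", " L ", " M ")" =>
  (∀ u ∈ LoopConfig.loops c, ∀ j₁ j₂ : Fin k, j₁ < j₂ →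
    ¬ ((u.range ∩ Metric.closedBall (0 : ℂ) ((M : Fin k → ℝ) j₁)).Nonempty ∧
      (u.range ∩ (Metric.ball (0 : ℂ) ((L : Fin k → ℝ) j₂))ᶜ).Nonempty))

namespace Staircase

/-- The staircase density is admissible data for the nesting transform: it vanishes off a ball and has
mean zero (`stub_cloudAdmissibility` + `Staircase.admissible`). -/
theorem density_data {t r : ℝ} {k : ℕ} {L M : Fin k → ℝ} (hk : 0 < k) (hr : 0 < r) (hrL : ∀ j, r ≤ L j)
    (hL : ∀ j, 0 < L j) (hLM : ∀ j, L j < M j) (hsep : ∀ j l, j < l → M j ≤ L l) :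
    ∃ R : ℝ, (∀ z : ℂ, R < ‖z‖ → (Stair(k, L, M, t, r)).density z = 0) ∧
      ∫ z, (Stair(k, L, M, t, r)).density z = 0 := by
  obtain ⟨-, -, ⟨R, hR⟩, h0⟩ :=
    stub_cloudAdmissibility (Stair(k, L, M, t, r)) (admissible rfl hk hr hrL hL hLM hsep)
  exact ⟨R, hR, h0⟩

/-! ## §4 Pathwise: `A = g_tot · U_rest`, `g_tot ≥ 0`, and the sandwich for `U_rest` on the good event -/

section Pathwise

variable {t r : ℝ} {k : ℕ} {L M : Fin k → ℝ}

/-- **Tower loops never cross a gap**, hence carry non-negative weights. -/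
theorem not_cross_of_mem_tow {c : LoopConfig ℂ} (hL1 : ∀ j, 1 ≤ L j) (hLM : ∀ j, L j < M j)
    (hsep : ∀ j l, j < l → M j ≤ L l) {u : UnbasedLoop ℂ} (hu : u ∈ Tow(c, k, L, M, r)) (j₁ j₂ : Fin k)
    (hj : j₁ < j₂) : ¬ ((u.range ∩ Metric.closedBall (0 : ℂ) (M j₁)).Nonempty ∧
      (u.range ∩ (Metric.ball (0 : ℂ) (L j₂))ᶜ).Nonempty) := by
  rintro ⟨⟨z, hzu, hz⟩, ⟨z', hz'u, hz'⟩⟩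
  rcases hu.2 with ⟨-, hwin⟩ | ⟨j, -, hin, hout⟩
  · exact hz' (Metric.ball_subset_ball (hL1 j₂) (hwin hz'u))
  · rcases lt_or_ge j j₂ with h | h
    · exact hz' (hout j₂ h hz'u)
    · -- `j₂ ≤ j`: the trace point `z ∈ B̄(0, M j₁) ⊆ B̄(0, M j)` would be interior to `u`
      have hMM : M j₁ ≤ M j := (hsep j₁ j (hj.trans_le h)).trans (hLM j).le
      have hzint : z ∈ {z | u.wind z ≠ 0} := hin (Metric.closedBall_subset_closedBall hMM hz)
      exact hzint (unbasedLoop_wind_of_mem_range u hzu)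

/-- **`g_tot ≥ 0`**: the product of the weights of the tower loops is non-negative (they never cross). -/
theorem finprod_tow_nonneg {c : LoopConfig ℂ} (ht : t ∈ Set.Icc (-(5 * π / 6)) 0) (htk : -t ≤ k * (π / 6))
    (hr : 0 < r) (hrL : ∀ j, r ≤ L j) (hL1 : ∀ j, 1 ≤ L j) (hLM : ∀ j, L j < M j)
    (hsep : ∀ j l, j < l → M j ≤ L l) :
    0 ≤ ∏ᶠ u ∈ Tow(c, k, L, M, r), u.nestingFactor (Stair(k, L, M, t, r)).density :=
  finprod_nonneg fun u ↦ finprod_nonneg fun hu ↦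
    (nestingFactor_nonneg_or_cross (𝔠 := Stair(k, L, M, t, r)) rfl ht htk hr hrL
      (fun j ↦ one_pos.trans_le (hL1 j)) hLM u).resolve_right
      fun ⟨j₁, j₂, hj, hc⟩ ↦ not_cross_of_mem_tow hL1 hLM hsep hu j₁ j₂ hj hc

/-- **Pathwise factorisation `A = g_tot · U_rest` on both lattices** (honest finite products). -/
theorem nestingWeight_eq_tow_mul_rest : ∀ E ∈ latticeEnsembles, ∀ {δ : ℝ}, 0 < δ → ∀ (ω : E.Ω),
    0 < k → 0 < r → (∀ j, r ≤ L j) → (∀ j, 0 < L j) → (∀ j, L j < M j) → (∀ j l, j < l → M j ≤ L l) →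
    (E.X δ ω).nestingWeight (Stair(k, L, M, t, r)).density =
      (∏ᶠ u ∈ Tow(E.X δ ω, k, L, M, r), u.nestingFactor (Stair(k, L, M, t, r)).density) *
        ∏ᶠ u ∈ (E.X δ ω).loops \ Tow(E.X δ ω, k, L, M, r), u.nestingFactor (Stair(k, L, M, t, r)).density := by
  intro E hE δ hδ ω hk hr hrL hL hLM hsep
  obtain ⟨R, hR, h0⟩ := density_data (t := t) hk hr hrL hL hLM hsep
  have hms : ((E.X δ ω).loops ∩ Function.mulSupport fun u : UnbasedLoop ℂ ↦
      u.nestingFactor (Stair(k, L, M, t, r)).density).Finite :=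
    (ConeTilt.finite_loops_meeting E hE hδ ω R).subset fun u hu ↦
      ⟨hu.1, range_inter_closedBall_nonempty_of_nestingFactor_ne_one hR h0 hu.2⟩
  have hT : Tow(E.X δ ω, k, L, M, r) ⊆ (E.X δ ω).loops := Set.sep_subset _ _
  rw [LoopConfig.nestingWeight, ← finprod_mem_union' Set.disjoint_sdiff_right
    (hms.subset (Set.inter_subset_inter_left _ hT)) (hms.subset (Set.inter_subset_inter_left _ Set.sdiff_subset)),
    Set.union_sdiff_cancel hT]

/-- **The sandwich for `U_rest` on the good event** (both lattices; `−t < k π/6` gives phases in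
`[t, −t/k]`, `−t/k < π/6`): with `Θ, Θ₂` the honest finite sums of the (squared) phases of the rest
loops and `c = min (cos(t + π/3)) (cos(−t/k + π/3))`, `exp(−√3Θ − Θ₂/c) ≤ U_rest ≤ exp(−√3Θ)`. -/
theorem finprod_rest_mem_Icc : ∀ E ∈ latticeEnsembles, ∀ {δ : ℝ}, 0 < δ → ∀ (ω : E.Ω),
    -(5 * π / 6) < t → t ≤ 0 → 0 < k → -t < k * (π / 6) → 0 < r → (∀ j, r ≤ L j) → (∀ j, 0 < L j) →
    (∀ j, L j < M j) → (∀ j l, j < l → M j ≤ L l) → Good(E.X δ ω, k, L, M) →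
    Real.exp (-(Real.sqrt 3 * ∑ᶠ u ∈ (E.X δ ω).loops \ Tow(E.X δ ω, k, L, M, r),
          u.nestingPhase (Stair(k, L, M, t, r)).density) -
        (∑ᶠ u ∈ (E.X δ ω).loops \ Tow(E.X δ ω, k, L, M, r), u.nestingPhase (Stair(k, L, M, t, r)).density ^ 2) /
          min (Real.cos (t + π / 3)) (Real.cos (-t / k + π / 3))) ≤
        ∏ᶠ u ∈ (E.X δ ω).loops \ Tow(E.X δ ω, k, L, M, r), u.nestingFactor (Stair(k, L, M, t, r)).density ∧
      ∏ᶠ u ∈ (E.X δ ω).loops \ Tow(E.X δ ω, k, L, M, r), u.nestingFactor (Stair(k, L, M, t, r)).density ≤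
        Real.exp (-(Real.sqrt 3 * ∑ᶠ u ∈ (E.X δ ω).loops \ Tow(E.X δ ω, k, L, M, r),
          u.nestingPhase (Stair(k, L, M, t, r)).density)) := by
  intro E hE δ hδ ω ht5 ht0 hk htk hr hrL hL hLM hsep hG
  obtain ⟨R, hR, h0⟩ := density_data (t := t) hk hr hrL hL hLM hsep
  set f := (Stair(k, L, M, t, r)).density with hf
  set Rest := (E.X δ ω).loops \ Tow(E.X δ ω, k, L, M, r) with hRest
  set Mt := {u ∈ (E.X δ ω).loops | (u.range ∩ closedBall (0 : ℂ) R).Nonempty} with hMt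
  have hfin : (Rest ∩ Mt).Finite := (ConeTilt.finite_loops_meeting E hE hδ ω R).subset Set.inter_subset_right
  set S := hfin.toFinset with hS
  have hθ0 : ∀ u ∈ Rest, u ∉ Rest ∩ Mt → u.nestingPhase f = 0 := fun u hu hu' ↦
    nestingPhase_eq_zero_of_disjoint hR h0 (Set.disjoint_iff_inter_eq_empty.2
      (Set.not_nonempty_iff_eq_empty.1 fun h ↦ hu' ⟨hu, hu.1, h⟩))
  have loc : ∀ g : UnbasedLoop ℂ → ℝ, (∀ u, u.nestingPhase f = 0 → g u = 0) →
      ∑ᶠ u ∈ Rest, g u = ∑ u ∈ S, g u := fun g hg ↦ by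
    rw [finsum_mem_inter_support_eq' g Rest (Rest ∩ Mt)
      fun u hu ↦ ⟨fun h ↦ by_contra fun h' ↦ hu (hg u (hθ0 u h h')), fun h ↦ h.1⟩,
      finsum_mem_eq_finite_toFinset_sum g hfin]
  have locp : ∏ᶠ u ∈ Rest, u.nestingFactor f = ∏ u ∈ S, u.nestingFactor f := by
    rw [finprod_mem_inter_mulSupport_eq' _ Rest (Rest ∩ Mt)
      fun u hu ↦ ⟨fun h ↦ by_contra fun h' ↦ hu
        (UnbasedLoop.nestingFactor_eq_one_of_nestingPhase_eq_zero (hθ0 u h h')), fun h ↦ h.1⟩,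
      finprod_mem_eq_finite_toFinset_prod _ hfin]
  rw [loc (fun u ↦ u.nestingPhase f) fun u h ↦ h, loc (fun u ↦ u.nestingPhase f ^ 2) fun u h ↦ by rw [h]; ring, locp]
  have hkpos : (0 : ℝ) < k := Nat.cast_pos.2 hk
  have hhi0 : 0 ≤ -t / k := div_nonneg (neg_nonneg.2 ht0) hkpos.le
  have hhi : -t / k < π / 6 := by rw [div_lt_iff₀ hkpos]; linarith
  refine UVLinear.prod_nestingFactor_mem_Icc_of_mem_Icc S f ht5 ht0 hhi0 hhi fun u hu ↦ ?_
  have huR : u ∈ Rest := (hfin.mem_toFinset.1 hu).1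
  exact (nestingPhase_mem_Icc_or_cross (𝔠 := Stair(k, L, M, t, r)) rfl ht0 hk hr hrL hL hLM u).resolve_right
    fun ⟨j₁, j₂, hj, hc⟩ ↦ hG u huR.1 j₁ j₂ hj hc

end Pathwise

end Staircase

/-- **Registered anchor (closed form of `Staircase.nestingWeight_eq_tow_mul_rest`).**  On both lattice
ensembles, at every mesh `δ > 0` and EVERY sample, the staircase functional factorises exactly as
`A = g_tot · U_rest`: `g_tot` the finite product of the weights of the TOWER loops (window tower: loops
surrounding `B̄(0, r)` inside `B(0, 1)`; gap tower `j`, `j + 1 < k`: loops surrounding `B̄(0, M j)` inside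
every `B(0, L l)`, `l > j` — all with deterministic phases `t`, resp. `t + (j+1)(−t/k)`), `U_rest` the
finite product over the remaining loops (sandwiched by `Staircase.finprod_rest_mem_Icc`). -/
theorem staircase_nestingWeight_eq_tow_mul_rest : ∀ E ∈ latticeEnsembles, ∀ {δ : ℝ}, 0 < δ →
    ∀ (ω : E.Ω) (t r : ℝ) (k : ℕ) (L M : Fin k → ℝ), 0 < k → 0 < r → (∀ j, r ≤ L j) → (∀ j, 0 < L j) →
    (∀ j, L j < M j) → (∀ j l, j < l → M j ≤ L l) →
    (E.X δ ω).nestingWeight (Cloud.mk 1 k (fun _ ↦ 0) (fun _ ↦ r) (fun _ ↦ t) (fun _ ↦ 0) L M (fun _ ↦ -t / k)).density =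
      (∏ᶠ u ∈ {u ∈ (E.X δ ω).loops | (Metric.closedBall (0 : ℂ) r ⊆ {z | u.wind z ≠ 0} ∧
          u.range ⊆ Metric.ball (0 : ℂ) 1) ∨ ∃ j : Fin k, (j : ℕ) + 1 < k ∧
          Metric.closedBall (0 : ℂ) (M j) ⊆ {z | u.wind z ≠ 0} ∧ ∀ l : Fin k, j < l → u.range ⊆ Metric.ball (0 : ℂ) (L l)},
        u.nestingFactor (Cloud.mk 1 k (fun _ ↦ 0) (fun _ ↦ r) (fun _ ↦ t) (fun _ ↦ 0) L M (fun _ ↦ -t / k)).density) *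
      ∏ᶠ u ∈ (E.X δ ω).loops \ {u ∈ (E.X δ ω).loops | (Metric.closedBall (0 : ℂ) r ⊆ {z | u.wind z ≠ 0} ∧
          u.range ⊆ Metric.ball (0 : ℂ) 1) ∨ ∃ j : Fin k, (j : ℕ) + 1 < k ∧
          Metric.closedBall (0 : ℂ) (M j) ⊆ {z | u.wind z ≠ 0} ∧ ∀ l : Fin k, j < l → u.range ⊆ Metric.ball (0 : ℂ) (L l)},
        u.nestingFactor (Cloud.mk 1 k (fun _ ↦ 0) (fun _ ↦ r) (fun _ ↦ t) (fun _ ↦ 0) L M (fun _ ↦ -t / k)).density :=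
  fun E hE _ hδ ω _ _ _ _ _ hk hr hrL hL hLM hsep ↦
    Staircase.nestingWeight_eq_tow_mul_rest E hE hδ ω hk hr hrL hL hLM hsep

end Summit.CriticalPhenomena.CardyFormulaZ2.Cruxes.NestingRigidity.RingCloudTomography

end
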